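import Summits.RiemannHypothesis.RiemannHypothesis.Theorems.MotivicDoorFfDoor
import Summits.RiemannHypothesis.RiemannHypothesis.Theorems.MotivicDoorFfDictionary

/-!
# Motivic door, function-field side (C)(i), part 6: BASE CHANGE — position versus count of windows
(pub-rhdoor seat ff-1.  HONEST FRAMING: lottery ticket at the motivic door; RH probability negligible; consolation
prizes are real: a new semi-local Weil-positivity theorem, or a located gap in the Connes–Consani programme, plus the
ff-door theorem.  No claim about `ζ`; "RH(q,h)" is `|α| = √q` for the complex roots of ONE integer polynomial `h`.
Every statement below is PROVED; there is no DATA in this file.)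

BASE CHANGE AS A MOVE ON WINDOW DATA.  Constant-field extension `𝔽_q → 𝔽_{q^N}` replaces the Frobenius
eigenvalues `α_j` by `α_j^N` and `q` by `q^N` ([folklore]; for `g = 1` e.g. Silverman, AEC 2nd ed., V.2.3.1:
`det(T - φ^n) = (T - α^n)(T - β^n)`, `#E(𝔽_{q^n}) = q^n + 1 - α^n - β^n`).  On the typed objects of
`PfPersistenceFfAngleTwin` this is the move `(q, A) ↦ (q^N, A^N)`, `A^N := A.map (· ^ N)`, and it acts on the
explicit-formula data by DECIMATION: the symbol becomes `K^{(N)}(n) = K(N n)` (`ffKernel_map_pow`) and the window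
form `T_M(q^N, A^N)` is the principal submatrix of `T_{N M}(q, A)` on the arithmetic progression `{0, N, …, N M}`
(`ffWindowForm_map_pow_eq_submatrix`; pub-weilobs FF.md T8 "base change = decimation" is the DATA antecedent, here
PROVED as an identity).  No integrality of the base-changed polynomial is needed or claimed: everything is stated for
the root multiset `(frobRoots h).map (· ^ N)` with parameter `q^N`.

THE STRIDE-`N` WEIL CRITERION.  ffmirror-2's finite criterion (`weilWindowForm_posSemidef_iff`, 4f1b3da6ffbf:
`T_M(q,h) ⪰ 0 ↔ RH(q,h)` for `deg h ≤ M + 1`) transfers along base change because its three structural hypotheses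
do (`A/√q` inversion-closed, conjugation-closed, `0 ∉ A/√q`) and `|z^N| = 1 ↔ |z| = 1` (`N ≥ 1`):
`T_M(q^N, (frobRoots h)^N) ⪰ 0 ↔ RH(q,h)` for every `N ≥ 1` and `deg h ≤ M + 1`
(`weilWindowForm_baseChange_posSemidef_iff`; coefficient-FE keyed `…_iff_ffRH`, last window `2g - 1`:
`weilWindowForm_baseChange_lastWindow_iff_ffRH`).  For `g = 1` ONE FAR LAG DECIDES:
`RH(q,h) ↔ |K(N)| ≤ K(0) = 1` for any single `N ≥ 1` (`ffRH_iff_ffKernel_norm_le_of_dim_one`, via the `2 × 2`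
window `ffWindowForm_one_posSemidef_iff`), i.e. the level-`N` Hasse bound `|α^N + β^N| ≤ 2 q^{N/2}` alone is
equivalent to RH for an honest datum of dimension `1`.

THE DOOR READING — POSITION VERSUS COUNT (sharpening FF-DOOR (i).D).  Parts 2 and 5 (`finiteWindow_matched_by_rhFalse`,
`ffDoor_fibre_density`): a reader of the PREFIX windows `T_0, …, T_M` is matched by honest RH-false fakes in every
dimension `g ≥ M + 1`.  Here (§5): for every stride `N ≥ 1` the STRIDE-`N` CORNER READER of depth `d`, which looks
only at the corner entries `K(N k) = T_{N k}(0, N k)` of the `d + 1` windows `T_0, T_N, …, T_{N d}` — arbitrarily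
sparse, arbitrarily far out (`strideCorner_congr`) — accepts an honest datum of dimension `g` with `2g ≤ d + 1`
IF AND ONLY IF it satisfies RH (`strideCornerReader_iff_ffRH`); and the same reader, being `(N d)`-local
(`strideCorner_local`), is matched by honest RH-false fakes in every dimension `g' ≥ N d + 1`
(`strideCornerReader_matched_above`, from part 2).  So what a window-local reader certifies is governed by the
NUMBER of informative lags it reads relative to the dimension — `2g` lags in arithmetic progression through `0`
always decide, a prefix of fewer than `g` never does — not by their POSITION.  (Whether a sparse set of fewer than
`g` lags, or between `g` and `2g - 1` lags, can certify RH at dimension `g` is not settled here; FF-DOOR (i).G.)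

NUMBER-FIELD READING (FF-DOOR (i).F, item 4; prose only).  The move `(q, A) ↦ (q^N, A^N)` has no counterpart over
`Spec ℤ` — there is no constant field to extend, and the decimated symbol `n ↦ K(N n)` of `ζ` is not the symbol of an
`L`-function (compare the `ζ(s) ↦ ζ(s/k)` bookkeeping in `SoloInformedKunnethDiagonal`).  The stride theorems are a
genuinely function-field feature of the door: recorded, not transferred.
-/

set_option linter.dupNamespace false

noncomputable section

open Polynomial Matrix
open scoped ComplexOrder ComplexConjugate

open Summit.RiemannHypothesis.RiemannHypothesis.Theorems.PfPersistence.FfAngleTwin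

namespace Summit.RiemannHypothesis.RiemannHypothesis.Theorems.MotivicDoor.FunctionField

/-! ## 1. Base change = decimation -/

/-- `s_n(A^N) = s_{N n}(A)`. [folklore] -/
theorem powerSum_map_pow (A : Multiset ℂ) (N n : ℕ) :
    powerSum (A.map (· ^ N)) n = powerSum A (N * n) := by
  simp only [powerSum, Multiset.map_map, Function.comp_def, ← pow_mul]

/-- Normalisation commutes with base change: `(A^N)/√(q^N) = (A/√q)^N` (uses `√(q^N) = (√q)^N`, cf.
`Literature.NumberTheory.Automorphic.real_sqrt_pow`, re-derived inline to keep the import cone small). [folklore] -/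
theorem normRoots_map_pow {q : ℝ} (hq : 0 ≤ q) (A : Multiset ℂ) (N : ℕ) :
    normRoots (q ^ N) (A.map (· ^ N)) = (normRoots q A).map (· ^ N) := by
  have hsqrt : Real.sqrt (q ^ N) = Real.sqrt q ^ N := by
    rw [← Real.sqrt_sq (pow_nonneg (Real.sqrt_nonneg q) N), ← pow_mul, mul_comm, pow_mul, Real.sq_sqrt hq]
  simp only [normRoots, Multiset.map_map, Function.comp_def, div_pow, hsqrt, Complex.ofReal_pow]

/-- BASE CHANGE DECIMATES THE SYMBOL: `K_{(q^N, A^N)}(n) = K_{(q, A)}(N n)`. [folklore] -/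
theorem ffKernel_map_pow {q : ℝ} (hq : 0 ≤ q) (A : Multiset ℂ) (N n : ℕ) :
    ffKernel (q ^ N) (A.map (· ^ N)) n = ffKernel q A (N * n) := by
  unfold ffKernel
  rw [normRoots_map_pow hq, powerSum_map_pow]

/-- Entrywise: `T_M(q^N, A^N)(m, m') = K_{(q, A)}(N |m - m'|)`. [folklore] -/
theorem ffWindowForm_map_pow_apply {q : ℝ} (hq : 0 ≤ q) (A : Multiset ℂ) (N M : ℕ) (m m' : Fin (M + 1)) :
    ffWindowForm (q ^ N) (A.map (· ^ N)) M m m' = ffKernel q A (N * Nat.dist m m') := by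
  simp only [ffWindowForm, Matrix.of_apply, ffKernel_map_pow hq]

/-- BASE CHANGE DECIMATES THE WINDOW FORM (pub-weilobs FF.md T8, as an identity): for any index map `e` realising
the progression `m ↦ N m`, `T_M(q^N, A^N)` is the principal submatrix of `T_{N M}(q, A)` on `{0, N, …, N M}`.
[folklore] -/
theorem ffWindowForm_map_pow_eq_submatrix {q : ℝ} (hq : 0 ≤ q) (A : Multiset ℂ) (N M : ℕ)
    (e : Fin (M + 1) → Fin (N * M + 1)) (he : ∀ m, (e m : ℕ) = N * m) :
    ffWindowForm (q ^ N) (A.map (· ^ N)) M = (ffWindowForm q A (N * M)).submatrix e e := by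
  ext m m'
  simp only [Matrix.submatrix_apply, ffWindowForm, Matrix.of_apply, ffKernel_map_pow hq, he, Nat.dist_mul_left]

/-- Hence positivity DESCENDS along base change: `T_{N M}(q, A) ⪰ 0 → T_M(q^N, A^N) ⪰ 0`. [folklore] -/
theorem ffWindowForm_map_pow_posSemidef_of_posSemidef {q : ℝ} (hq : 0 ≤ q) {A : Multiset ℂ} {N M : ℕ}
    (hpsd : (ffWindowForm q A (N * M)).PosSemidef) :
    (ffWindowForm (q ^ N) (A.map (· ^ N)) M).PosSemidef := by
  let e : Fin (M + 1) → Fin (N * M + 1) := fun m =>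
    ⟨N * m, Nat.lt_succ_of_le (Nat.mul_le_mul_left N (Fin.is_le m))⟩
  rw [ffWindowForm_map_pow_eq_submatrix hq A N M e fun m => rfl]
  exact hpsd.submatrix e

/-! ## 2. The structural hypotheses of the Weil criterion survive base change -/

/-- Inversion-closed ⇒ the `N`-th powers are inversion-closed. [folklore] -/
theorem map_pow_map_inv {U : Multiset ℂ} (hinv : U.map (·⁻¹) = U) (N : ℕ) :
    (U.map (· ^ N)).map (·⁻¹) = U.map (· ^ N) := by
  conv_rhs => rw [← hinv]
  simp only [Multiset.map_map, Function.comp_def, inv_pow]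

/-- Conjugation-closed ⇒ the `N`-th powers are conjugation-closed. [folklore] -/
theorem map_pow_map_conj {U : Multiset ℂ} (hconj : U.map conj = U) (N : ℕ) :
    (U.map (· ^ N)).map conj = U.map (· ^ N) := by
  conv_rhs => rw [← hconj]
  simp only [Multiset.map_map, Function.comp_def, map_pow]

/-- `0 ∉ U ⇒ 0 ∉ U^N`. [folklore] -/
theorem zero_not_mem_map_pow {U : Multiset ℂ} (h0 : (0 : ℂ) ∉ U) (N : ℕ) : (0 : ℂ) ∉ U.map (· ^ N) := by
  intro h
  obtain ⟨z, hz, hzN⟩ := Multiset.mem_map.1 h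
  exact pow_ne_zero N (fun hz0 => h0 (hz0 ▸ hz)) hzN

/-- `|z^N| = 1` for all `z ∈ U` and `N ≥ 1` ⇒ `|z| = 1` on `U`. [folklore] -/
theorem norm_eq_one_of_map_pow {U : Multiset ℂ} {N : ℕ} (hN : N ≠ 0)
    (h : ∀ w ∈ U.map (· ^ N), ‖w‖ = 1) : ∀ z ∈ U, ‖z‖ = 1 := by
  intro z hz
  have h1 := h (z ^ N) (Multiset.mem_map_of_mem _ hz)
  rw [norm_pow] at h1
  exact (pow_eq_one_iff_of_nonneg (norm_nonneg z) hN).1 h1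

/-- A conjugation-closed multiset has real power sums. [folklore] -/
theorem conj_powerSum {U : Multiset ℂ} (hconj : U.map conj = U) (n : ℕ) :
    conj (powerSum U n) = powerSum U n := by
  conv_rhs => rw [← hconj]
  unfold powerSum
  rw [map_multiset_sum, Multiset.map_map, Multiset.map_map]
  simp only [Function.comp_def, map_pow]

/-- … hence a real symbol: `K(n) ∈ ℝ` whenever `A/√q` is conjugation-closed (no positivity needed). [folklore] -/
theorem ffKernel_im_eq_zero_of_conj {q : ℝ} {A : Multiset ℂ}
    (hconj : (normRoots q A).map conj = normRoots q A) (n : ℕ) : (ffKernel q A n).im = 0 :=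
  Complex.conj_eq_iff_im.1 (by rw [ffKernel, map_div₀, conj_powerSum hconj, map_ofNat])

/-! ## 3. The stride-`N` Weil criterion -/

/-- STRIDE-`N` WEIL CRITERION, multiset level (ffmirror-2's `norm_eq_one_of_ffWindowForm_posSemidef` applied to the
base-changed datum): if `A/√q` is inversion- and conjugation-closed and misses `0`, `#A ≤ M + 1` and `N ≥ 1`, then
`T_M(q^N, A^N) ⪰ 0` forces `|α| = √q` on `A`. [folklore] -/
theorem norm_eq_one_of_ffWindowForm_map_pow_posSemidef {q : ℝ} (hq : 0 ≤ q) {A : Multiset ℂ}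
    (hinv : (normRoots q A).map (·⁻¹) = normRoots q A)
    (hconj : (normRoots q A).map conj = normRoots q A) (h0 : (0 : ℂ) ∉ normRoots q A)
    {N : ℕ} (hN : N ≠ 0) {M : ℕ} (hM : Multiset.card A ≤ M + 1)
    (hpsd : (ffWindowForm (q ^ N) (A.map (· ^ N)) M).PosSemidef) :
    ∀ z ∈ normRoots q A, ‖z‖ = 1 := by
  have key := norm_eq_one_of_ffWindowForm_posSemidef (q := q ^ N) (A := A.map (· ^ N)) (M := M)
    (by rw [normRoots_map_pow hq]; exact map_pow_map_inv hinv N)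
    (by rw [normRoots_map_pow hq]; exact map_pow_map_conj hconj N)
    (by rw [normRoots_map_pow hq]; exact zero_not_mem_map_pow h0 N)
    (by rwa [Multiset.card_map]) hpsd
  rw [normRoots_map_pow hq] at key
  exact norm_eq_one_of_map_pow hN key

/-- … both directions: `T_M(q^N, A^N) ⪰ 0 ↔ |z| = 1 on A/√q` (⇐ is ffmirror-2's Gram positivity for the
base-changed datum). [folklore] -/
theorem ffWindowForm_map_pow_posSemidef_iff {q : ℝ} (hq : 0 ≤ q) {A : Multiset ℂ}
    (hinv : (normRoots q A).map (·⁻¹) = normRoots q A)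
    (hconj : (normRoots q A).map conj = normRoots q A) (h0 : (0 : ℂ) ∉ normRoots q A)
    {N : ℕ} (hN : N ≠ 0) {M : ℕ} (hM : Multiset.card A ≤ M + 1) :
    (ffWindowForm (q ^ N) (A.map (· ^ N)) M).PosSemidef ↔ ∀ z ∈ normRoots q A, ‖z‖ = 1 := by
  refine ⟨norm_eq_one_of_ffWindowForm_map_pow_posSemidef hq hinv hconj h0 hN hM, fun hmod => ?_⟩
  refine ffWindowForm_posSemidef (q := q ^ N) (A := A.map (· ^ N)) ?_ ?_ M
  · rw [normRoots_map_pow hq]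
    intro w hw
    obtain ⟨z, hz, rfl⟩ := Multiset.mem_map.1 hw
    simp only [norm_pow, hmod z hz, one_pow]
  · rw [normRoots_map_pow hq]
    exact map_pow_map_conj hconj N

/-- STRIDE-`N` WEIL CRITERION for `(q, h)` under ffmirror-2's hypotheses (`(frobRoots h).map (q/·) = frobRoots h`,
`0 ∉ frobRoots h`): for `deg h ≤ M + 1` and every `N ≥ 1`, `T_M(q^N, (frobRoots h)^N) ⪰ 0 ↔ RH(q,h)`.
The case `N = 1` is `weilWindowForm_posSemidef_iff`. [folklore] -/
theorem weilWindowForm_baseChange_posSemidef_iff {q : ℝ} (hq : 0 < q) {h : ℤ[X]}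
    (hrec : (frobRoots h).map (fun α => (q : ℂ) / α) = frobRoots h) (h0 : (0 : ℂ) ∉ frobRoots h)
    {N : ℕ} (hN : N ≠ 0) {M : ℕ} (hM : h.natDegree ≤ M + 1) :
    (ffWindowForm (q ^ N) ((frobRoots h).map (· ^ N)) M).PosSemidef ↔
      ∀ α ∈ frobRoots h, ‖α‖ = Real.sqrt q := by
  have hs : (0 : ℝ) < Real.sqrt q := Real.sqrt_pos.2 hq
  have h0' : (0 : ℂ) ∉ normRoots q (frobRoots h) := by
    intro hz
    obtain ⟨α, hα, hα0⟩ := Multiset.mem_map.1 hz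
    rcases div_eq_zero_iff.1 hα0 with h1 | h1
    · exact h0 (h1 ▸ hα)
    · exact hs.ne' (by exact_mod_cast h1)
  rw [ffWindowForm_map_pow_posSemidef_iff hq.le (normRoots_map_inv_of_reciprocal hq hrec)
    (normRoots_frobRoots_map_conj q h) h0' hN (by rwa [card_frobRoots_eq_natDegree])]
  refine ⟨fun hmod α hα => ?_, normRoots_norm_eq_one hq⟩
  have h1 := hmod (α / (Real.sqrt q : ℂ)) (Multiset.mem_map_of_mem _ hα)
  rwa [norm_div, Complex.norm_real, Real.norm_eq_abs, abs_of_pos hs, div_eq_one_iff_eq hs.ne'] at h1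

/-- STRIDE-`N` WEIL CRITERION, coefficient-FE keyed (the cell's honest data; dictionary of part 3): for `deg h = 2g`,
the FE `q^g c_j = q^i c_i (i + j = 2g)`, `2g ≤ M + 1` and every `N ≥ 1`,
`T_M(q^N, (frobRoots h)^N) ⪰ 0 ↔ RH(q,h)`. [folklore] -/
theorem weilWindowForm_baseChange_posSemidef_iff_ffRH {q : ℕ} (hq : 0 < q) {h : ℤ[X]} {g : ℕ}
    (hdeg : h.natDegree = 2 * g)
    (hFE : ∀ i j, i + j = 2 * g → (q : ℤ) ^ g * h.coeff j = (q : ℤ) ^ i * h.coeff i)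
    {N : ℕ} (hN : N ≠ 0) {M : ℕ} (hM : 2 * g ≤ M + 1) :
    (ffWindowForm ((q : ℝ) ^ N) ((frobRoots h).map (· ^ N)) M).PosSemidef ↔
      ∀ α ∈ frobRoots h, ‖α‖ = Real.sqrt q := by
  have hrec : (frobRoots h).map (fun α => ((q : ℝ) : ℂ) / α) = frobRoots h := by
    simpa only [Complex.ofReal_natCast] using frobRoots_map_reciprocal hq hdeg hFE
  exact weilWindowForm_baseChange_posSemidef_iff (by exact_mod_cast hq) hrec (zero_not_mem_frobRoots hq hdeg hFE)
    hN (by rw [hdeg]; exact hM)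

/-- THE LAST WINDOW OF ANY STRIDE DECIDES: for an honest datum of dimension `g ≥ 1` and every `N ≥ 1`,
`T_{2g-1}(q^N, (frobRoots h)^N) ⪰ 0 ↔ RH(q,h)` — the `2g` lags `0, N, …, (2g-1)N` decide RH. [folklore] -/
theorem weilWindowForm_baseChange_lastWindow_iff_ffRH {q : ℕ} (hq : 0 < q) {h : ℤ[X]} {g : ℕ} (hg : 1 ≤ g)
    (hdeg : h.natDegree = 2 * g)
    (hFE : ∀ i j, i + j = 2 * g → (q : ℤ) ^ g * h.coeff j = (q : ℤ) ^ i * h.coeff i)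
    {N : ℕ} (hN : N ≠ 0) :
    (ffWindowForm ((q : ℝ) ^ N) ((frobRoots h).map (· ^ N)) (2 * g - 1)).PosSemidef ↔
      ∀ α ∈ frobRoots h, ‖α‖ = Real.sqrt q :=
  weilWindowForm_baseChange_posSemidef_iff_ffRH hq hdeg hFE hN (by omega)

/-! ## 4. Dimension one: a single far lag decides -/

/-- THE `2 × 2` WINDOW: `T_1(q, B) ⪰ 0 ↔ K(1) ∈ ℝ ∧ |K(1)| ≤ K(0)` (`K(0) = #B/2 ≥ 0`). [folklore] -/
theorem ffWindowForm_one_posSemidef_iff (q : ℝ) (B : Multiset ℂ) :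
    (ffWindowForm q B 1).PosSemidef ↔
      (ffKernel q B 1).im = 0 ∧ ‖ffKernel q B 1‖ ≤ ‖ffKernel q B 0‖ := by
  refine ⟨fun h => ⟨ffKernel_im_eq_zero_of_posSemidef h, ffKernel_norm_le_of_posSemidef h⟩,
    fun ⟨him, hle⟩ => ?_⟩
  -- `d = K(0) = #B/2 ≥ 0`, `κ = K(1) ∈ ℝ`, `|κ| ≤ d`
  set d : ℝ := (Multiset.card B : ℝ) / 2 with hd
  set κ : ℝ := (ffKernel q B 1).re with hκ
  have hd0 : 0 ≤ d := by positivity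
  have hK0 : ffKernel q B 0 = (d : ℂ) := by
    rw [ffKernel_zero, hd]; push_cast; ring
  have hK1 : ffKernel q B 1 = (κ : ℂ) :=
    (Complex.conj_eq_iff_re.1 (Complex.conj_eq_iff_im.2 him)).symm
  have hκd : |κ| ≤ d := by
    have h := hle
    rwa [hK0, hK1, Complex.norm_real, Complex.norm_real, Real.norm_eq_abs, Real.norm_eq_abs,
      abs_of_nonneg hd0] at h
  -- the four entries
  have h00 : ffWindowForm q B 1 0 0 = (d : ℂ) := by simp [ffWindowForm, Nat.dist, hK0]
  have h11 : ffWindowForm q B 1 1 1 = (d : ℂ) := by simp [ffWindowForm, Nat.dist, hK0]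
  have h01 : ffWindowForm q B 1 0 1 = (κ : ℂ) := by simp [ffWindowForm, Nat.dist, hK1]
  have h10 : ffWindowForm q B 1 1 0 = (κ : ℂ) := by simp [ffWindowForm, Nat.dist, hK1]
  have hH : (ffWindowForm q B 1).IsHermitian := by
    refine Matrix.IsHermitian.ext fun i j => ?_
    fin_cases i <;> fin_cases j <;> simp [h00, h01, h10, h11]
  refine Matrix.PosSemidef.of_dotProduct_mulVec_nonneg hH fun x => ?_
  have hform : star x ⬝ᵥ (ffWindowForm q B 1 *ᵥ x) =
      ((d * (‖x 0‖ ^ 2 + ‖x 1‖ ^ 2) + 2 * κ * (conj (x 0) * x 1).re : ℝ) : ℂ) := by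
    simp only [dotProduct, Matrix.mulVec, Pi.star_apply, Complex.star_def]
    apply Complex.ext <;>
      simp [ffWindowForm, Matrix.of_apply, Nat.dist, hK0, hK1, Complex.mul_re, Complex.mul_im, Complex.sq_norm,
        Complex.normSq_apply] <;> ring
  rw [hform, Complex.zero_le_real]
  have hr : |(conj (x 0) * x 1).re| ≤ ‖x 0‖ * ‖x 1‖ := by
    calc |(conj (x 0) * x 1).re| ≤ ‖conj (x 0) * x 1‖ := Complex.abs_re_le_norm _
      _ = ‖x 0‖ * ‖x 1‖ := by rw [norm_mul, Complex.norm_conj]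
  have h1 : |κ * (conj (x 0) * x 1).re| ≤ d * (‖x 0‖ * ‖x 1‖) := by
    rw [abs_mul]; exact mul_le_mul hκd hr (abs_nonneg _) hd0
  have h2 : -(d * (‖x 0‖ * ‖x 1‖)) ≤ κ * (conj (x 0) * x 1).re := (abs_le.1 h1).1
  nlinarith [mul_nonneg hd0 (sq_nonneg (‖x 0‖ - ‖x 1‖)), h2, norm_nonneg (x 0), norm_nonneg (x 1)]

/-- `g = 1`: ONE FAR LAG DECIDES.  For an honest datum of dimension `1` (`deg h = 2`, `q c_1 = q c_1`, `c_0 = q`) and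
any single `N ≥ 1`: `RH(q,h) ↔ |K(N)| ≤ K(0) = 1`, i.e. the level-`N` Hasse bound `|α^N + β^N| ≤ 2 q^{N/2}` ALONE is
equivalent to RH — the reader of the two windows `T_0, T_N` decides. (⇒ is part 1's `ffKernel_norm_le_of_ffRH`;
⇐ is the stride-`N` criterion at depth `1` via the `2 × 2` window.) [folklore] -/
theorem ffRH_iff_ffKernel_norm_le_of_dim_one {q : ℕ} (hq : 0 < q) {h : ℤ[X]} (hdeg : h.natDegree = 2)
    (hFE : ∀ i j, i + j = 2 → (q : ℤ) * h.coeff j = (q : ℤ) ^ i * h.coeff i) {N : ℕ} (hN : N ≠ 0) :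
    (∀ α ∈ frobRoots h, ‖α‖ = Real.sqrt q) ↔
      ‖ffKernel (q : ℝ) (frobRoots h) N‖ ≤ ‖ffKernel (q : ℝ) (frobRoots h) 0‖ := by
  have hq' : (0 : ℝ) < q := by exact_mod_cast hq
  refine ⟨fun hRH => ffKernel_norm_le_of_ffRH hq' hRH N, fun hle => ?_⟩
  have hdeg' : h.natDegree = 2 * 1 := by simpa using hdeg
  have hFE' : ∀ i j, i + j = 2 * 1 → (q : ℤ) ^ 1 * h.coeff j = (q : ℤ) ^ i * h.coeff i := by
    simpa using hFE
  refine (weilWindowForm_baseChange_posSemidef_iff_ffRH hq hdeg' hFE' hN (M := 1) (by norm_num)).1 ?_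
  refine (ffWindowForm_one_posSemidef_iff _ _).2 ⟨?_, ?_⟩
  · rw [ffKernel_map_pow hq'.le, mul_one]
    exact ffKernel_im_eq_zero_of_conj (normRoots_frobRoots_map_conj (q : ℝ) h) N
  · rwa [ffKernel_map_pow hq'.le, ffKernel_map_pow hq'.le, mul_one, mul_zero]

/-! ## 5. The door reading: stride readers — position versus count

The STRIDE-`N` CORNER MATRIX of depth `d` of a tower `T` is `(T_{N|m-m'|}(0, last))_{0 ≤ m, m' ≤ d}`; its positive
semidefiniteness is the STRIDE-`N` CORNER READER `Φ_{N,d}`.  It is typed inline (no definition is introduced). -/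

/-- SPARSE DEPENDENCE: the stride-`N` corner matrix of depth `d` is determined by the `d + 1` windows
`T_0, T_N, …, T_{N d}` (indeed by their corner entries). [folklore] -/
theorem strideCorner_congr {N d : ℕ} {T T' : Tower} (hTT' : ∀ k ≤ d, T (N * k) = T' (N * k)) :
    (Matrix.of fun m m' : Fin (d + 1) => T (N * Nat.dist m m') 0 (Fin.last _)) =
      Matrix.of fun m m' : Fin (d + 1) => T' (N * Nat.dist m m') 0 (Fin.last _) := by
  ext m m'
  have hmd : Nat.dist m m' ≤ d := by
    have := m.2; have := m'.2; unfold Nat.dist; omega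
  simp only [Matrix.of_apply, hTT' _ hmd]

/-- … in particular it is a FINITE-WINDOW matrix of depth `N d` in the sense of part 2 (`hloc`). [folklore] -/
theorem strideCorner_local {N d : ℕ} {T T' : Tower} (hTT' : ∀ M' ≤ N * d, T M' = T' M') :
    (Matrix.of fun m m' : Fin (d + 1) => T (N * Nat.dist m m') 0 (Fin.last _)) =
      Matrix.of fun m m' : Fin (d + 1) => T' (N * Nat.dist m m') 0 (Fin.last _) :=
  strideCorner_congr fun _ hk => hTT' _ (Nat.mul_le_mul_left N hk)

/-- On the tower of a datum the stride-`N` corner matrix IS the window form of the base-changed datum: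
`(K(N|m - m'|))_{m,m' ≤ d} = T_d(q^N, (frobRoots h)^N)`. [folklore] -/
theorem strideCorner_weilWindowTower {q : ℝ} (hq : 0 ≤ q) (h : ℤ[X]) (N d : ℕ) :
    (Matrix.of fun m m' : Fin (d + 1) => weilWindowTower q h (N * Nat.dist m m') 0 (Fin.last _)) =
      ffWindowForm (q ^ N) ((frobRoots h).map (· ^ N)) d := by
  ext m m'
  rw [Matrix.of_apply, weilWindowTower_corner, ffWindowForm_map_pow_apply hq]

/-- FF-DOOR (i), POSITION: STRIDE READERS DECIDE RH AT FIXED DIMENSION.  For every `q ≥ 1`, stride `N ≥ 1` and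
depth `d` with `2g ≤ d + 1`, the stride-`N` corner reader — a functional of the windows `T_0, T_N, …, T_{N d}` only —
accepts an honest datum `(q, h)` of dimension `g` if and only if RH(q,h) holds.  With `d = 2g - 1`: the `2g` corner
entries `K(0), K(N), …, K((2g-1)N)` decide; with `g = d = 1`: the two windows `T_0, T_N` decide. [folklore] -/
theorem strideCornerReader_iff_ffRH {q : ℕ} (hq : 0 < q) {h : ℤ[X]} {g : ℕ}
    (hdeg : h.natDegree = 2 * g)
    (hFE : ∀ i j, i + j = 2 * g → (q : ℤ) ^ g * h.coeff j = (q : ℤ) ^ i * h.coeff i)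
    {N : ℕ} (hN : N ≠ 0) {d : ℕ} (hd : 2 * g ≤ d + 1) :
    (Matrix.of fun m m' : Fin (d + 1) =>
        weilWindowTower (q : ℝ) h (N * Nat.dist m m') 0 (Fin.last _)).PosSemidef ↔
      ∀ α ∈ frobRoots h, ‖α‖ = Real.sqrt q := by
  rw [strideCorner_weilWindowTower (Nat.cast_nonneg q)]
  exact weilWindowForm_baseChange_posSemidef_iff_ffRH hq hdeg hFE hN hd

/-- FF-DOOR (i), COUNT: the same reader is `(N d)`-local, hence (part 2, `finiteWindow_matched_by_rhFalse`) in every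
dimension `g' ≥ N d + 1` an honest datum it accepts is MATCHED by an honest RH-false datum it also accepts (`q ≥ 2`).
Together with `strideCornerReader_iff_ffRH`: certification is governed by the number of informative lags read
relative to the dimension, not by their position. [folklore] -/
theorem strideCornerReader_matched_above {q : ℕ} (hq : 2 ≤ q) {N d g' : ℕ} (hg' : N * d + 1 ≤ g') {h : ℤ[X]}
    (hh : h.Monic) (hdeg : h.natDegree = 2 * g')
    (hFE : ∀ i j, i + j = 2 * g' → (q : ℤ) ^ g' * h.coeff j = (q : ℤ) ^ i * h.coeff i)
    (hΦ : (Matrix.of fun m m' : Fin (d + 1) =>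
        weilWindowTower (q : ℝ) h (N * Nat.dist m m') 0 (Fin.last _)).PosSemidef) :
    ∃ h' : ℤ[X], h'.Monic ∧ h'.natDegree = 2 * g' ∧
      (∀ i j, i + j = 2 * g' → (q : ℤ) ^ g' * h'.coeff j = (q : ℤ) ^ i * h'.coeff i) ∧
      (¬ ∀ α ∈ frobRoots h', ‖α‖ = Real.sqrt q) ∧
      (Matrix.of fun m m' : Fin (d + 1) =>
        weilWindowTower (q : ℝ) h' (N * Nat.dist m m') 0 (Fin.last _)).PosSemidef :=
  finiteWindow_matched_by_rhFalse
    (Φ := fun T : Tower =>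
      (Matrix.of fun m m' : Fin (d + 1) => T (N * Nat.dist m m') 0 (Fin.last _)).PosSemidef)
    (M := N * d)
    (fun T T' hTT' hT => by
      show (Matrix.of fun m m' : Fin (d + 1) => T' (N * Nat.dist m m') 0 (Fin.last _)).PosSemidef
      rw [← strideCorner_local hTT']
      exact hT)
    hq hg' hh hdeg hFE hΦ

end Summit.RiemannHypothesis.RiemannHypothesis.Theorems.MotivicDoor.FunctionField

end
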